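import Mathlib
import HarnessLib
import Summits.HubbardSuperconductivity.HubbardSuperconductivity.Theorems.KLProgrammeKLRegimeSplitTwoLegMomentsFromGridAll
import Summits.HubbardSuperconductivity.HubbardSuperconductivity.Theorems.KLProgrammeKLRegimeSplitTwoLegFieldStrengthCounterterm

/-!
# Route `KLProgramme` — K3 gen 8 ENGINE child `KLRegimeEngineV17F2` (stmt-HubbardSuperconductivity-20437), stub (e) `stub_twoLeg_step` at the
# INDUCTIVE scales: the grid→(E3d)/(E3e) bridge AT EVERY SCALE `n` AND EVERY FRAME `K`, representation DISCHARGED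

Cell gate-hubbard-kl, seat hubbard-kl-r2d-p1 (g6).  Stub (e)'s residual rows B (HOME/hubbard-kl-r2d-p1/RESIDUAL-TABLE-e-V17F.md v4) are the two SIZES of
the scale-`n` one-shot action at the flow frame `K_n`: B1′ `|z_n(K_n)(k⃗) − 1| ≤ Z·U²` on the shell and B2′ the gradient of the `K_n`-separated reading
`I_L[Re Σ_n(K_n) − K_n∘p]` on the shell tube `≤ S·U²`.  At `(K, n) = (0, 0)` p1b/p3 read both off GRID DATA of the scale-`0` grid effective action
(`…TwoLegMomentsFromGridAll`, `…TwoLegTimeMomentFromGrid`, `…TwoLegFieldStrengthCounterterm`): the momentum-side sup-jets of `I_L[σ − K∘p]` from the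
pinned off-diagonal `(1+|Δx̃₀|+|Δx̃₁|)ᵏ`-weighted sums of `kernel₂`, and `|z − 1|` from its circular temporal first moment.  The representation behind
them, `𝒱^{(n)}[K] = map S_{4M} (effAction (S_{4M}ᵀ C^K_{>Λ_n} S_{4M}) (V_{4M} + 𝒩_{K,4M}))`, is p3 g5's `EngineV8.klEffectiveAction_eq_map_hubbardGridSub`
and holds at EVERY scale `n` (`Λ_n = klScale klE0 n`) and every frame `K` — so the whole bridge does.  This file records it:

* §1 **`klEffectiveAction_sub_counterQuadratic_eq_map_gridSub_scale`** — `𝒱^{(n)}[K] − 𝒩_K = map S_{4M} (W_n[K] − 𝒩_{K,4M})`,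
  `W_n[K] := effAction (S_{4M}ᵀ C^K_{>Λ_n} S_{4M}) (V_{4M} + 𝒩_{K,4M})` (p3's `…_zero_…` verbatim with `n` for `0`); `klFieldStrength_eq_fieldStrength_sub_counter`;
* §2 **`twoLeg_sep_momentumSizes_of_grid_scale`** — every order `k`: pinned plain (`B 0`) and off-diagonal weighted (`B k`, `k ≥ 1`) sums of
  `kernel₂ (W_n[K] − 𝒩_{K,4M})` ⇒ `‖Dᵏ evalM (symInterp L (klLocSelfEnergyRe … K n − K∘p))‖ ≤ (2·|GridPoint L 4M|/(|β|L²))·B k`;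
  **`twoLeg_sep_iteratedFDeriv_of_grid_offDiag`** — the SINGLE-ORDER form (one `k ≥ 1`, one weighted sum, any representation `map S W`) and its scale-`n`
  instance **`twoLeg_sep_fderiv_of_grid_scale`** (`k = 1`, `‖fderiv‖`-form = row B2′'s left side at every `q`, hence on the tube);
* §3 **`abs_klFieldStrength_sub_one_le_of_grid_time_moment_scale`** / **`…_sub_counter_scale`** — `|klFieldStrength … K n k⃗ − 1| ≤ (2·4M/β)·Bᵗ` from the
  circular grid time moment of `kernel₂ W_n[K]` (resp. of `kernel₂ (W_n[K] − 𝒩_{K,4M})`, the counterterm being invisible to `z`) = row B1′'s left side.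

So residual B of stub (e) at `(K_n, n)` is, verbatim, TWO pinned weighted sums of the two-leg grid kernel of the scale-`n` one-shot grid action at `K_n`
(the consumer shell is `EngineV8.stub_twoLeg_step_of_gridMoments_GQ`, companion file).  Proofs only; no definitions; nothing about the model is asserted;
nothing asserts superconductivity.  References: BGM 2006 §2.1 (2.4)–(2.5), §2.3 (2.17), (2.23), §2.4 (2.36) [cite: BenfattoGiulianiMastropietro2006].
-/

noncomputable section

namespace Summit.HubbardSuperconductivity.HubbardSuperconductivity.Theorems.TwoLegFourier

set_option linter.dupNamespace false -- summit = problem name (single-conjunct summit), D-0017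

open Finset Complex
open Literature.MathematicalPhysics.QuantumLattice Literature.Probability.LatticeModels GrassmannAlgebra
open Summit.HubbardSuperconductivity.HubbardSuperconductivity.Theorems.KLRegimeSplit
open Summit.HubbardSuperconductivity.HubbardSuperconductivity.Theorems.KLProgrammeLegKernels
open Summit.HubbardSuperconductivity.HubbardSuperconductivity.Theorems.EngineV8

variable {L M : ℕ} [NeZero L] [NeZero M]

/-! ## §1 The scale-`n` representation, discharged -/

/-- **`𝒱^{(n)}[K] − 𝒩_K` IS the grid image of the scale-`n` grid effective action minus the grid counterterm** (`N = 4M`, every `n`, every `K`):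
`klEffectiveAction … K klE0 n − counterQuadratic K = map (toLin' (gridSubMatrix β (·.2) (gridTime β 4M ·.1))) (W_n[K] − 𝒩_{K,4M})`,
`W_n[K] = effAction (S_{4M}ᵀ C^K_{>Λ_n} S_{4M}) (V_{4M} + 𝒩_{K,4M})`, `Λ_n = klScale klE0 n`. -/
theorem klEffectiveAction_sub_counterQuadratic_eq_map_gridSub_scale {β : ℝ} (hβ : β ≠ 0) (U μ : ℝ) (K : TrigPolyC4v) (n : ℕ) :
    klEffectiveAction L M β U μ K klE0 n - counterQuadratic L M β K =
      ExteriorAlgebra.map (Matrix.toLin' (gridSubMatrix L M β (fun p : GridPoint L (2 * (2 * M)) => p.2)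
          (fun p => gridTime β (2 * (2 * M)) p.1)))
        (effAction ℂ ((hubbardGridSub L M β (2 * (2 * M))).transpose * hubbardCovAboveCT L M β μ 0 K (klScale klE0 n) *
            hubbardGridSub L M β (2 * (2 * M)))
          (hubbardGridInteraction L (2 * (2 * M)) β U + hubbardGridCounterQuadratic L (2 * (2 * M)) β K) -
          hubbardGridCounterQuadratic L (2 * (2 * M)) β K) := by
  haveI : NeZero (2 * (2 * M) : ℕ) := ⟨by have := NeZero.ne M; omega⟩
  rw [map_sub, show gridSubMatrix L M β (fun p : GridPoint L (2 * (2 * M)) => p.2) (fun p => gridTime β (2 * (2 * M)) p.1) =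
      hubbardGridSub L M β (2 * (2 * M)) from rfl,
    klEffectiveAction_eq_map_hubbardGridSub (N := 2 * (2 * M)) hβ U μ K klE0 n (by omega) (by omega),
    map_hubbardGridSub_gridCounterQuadratic (L := L) (M := M) (N := 2 * (2 * M)) hβ K (by omega)]

/-- **The scale-`n` action itself is the grid image of `W_n[K]`** on the `(·.2, gridTime)` presentation of the grid substitution (the form the
field-strength bridge reads). -/
theorem klEffectiveAction_eq_map_gridSub_scale {β : ℝ} (hβ : β ≠ 0) (U μ : ℝ) (K : TrigPolyC4v) (n : ℕ) :
    klEffectiveAction L M β U μ K klE0 n =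
      ExteriorAlgebra.map (Matrix.toLin' (gridSubMatrix L M β (fun p : GridPoint L (2 * (2 * M)) => p.2)
          (fun p => gridTime β (2 * (2 * M)) p.1)))
        (effAction ℂ ((hubbardGridSub L M β (2 * (2 * M))).transpose * hubbardCovAboveCT L M β μ 0 K (klScale klE0 n) *
            hubbardGridSub L M β (2 * (2 * M)))
          (hubbardGridInteraction L (2 * (2 * M)) β U + hubbardGridCounterQuadratic L (2 * (2 * M)) β K)) := by
  haveI : NeZero (2 * (2 * M) : ℕ) := ⟨by have := NeZero.ne M; omega⟩
  rw [show gridSubMatrix L M β (fun p : GridPoint L (2 * (2 * M)) => p.2) (fun p => gridTime β (2 * (2 * M)) p.1) =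
      hubbardGridSub L M β (2 * (2 * M)) from rfl]
  exact klEffectiveAction_eq_map_hubbardGridSub (N := 2 * (2 * M)) hβ U μ K klE0 n (by omega) (by omega)

/-- **`klFieldStrength … K n k⃗ = fieldStrength (𝒱^{(n)} − 𝒩_K) k⃗`** — the field strength does not see the counterterm, at every scale. -/
theorem klFieldStrength_eq_fieldStrength_sub_counter {β : ℝ} (hβ : β ≠ 0) (U μ : ℝ) (K : TrigPolyC4v) (n : ℕ) (k : TorusSite 2 L) :
    klFieldStrength L M β U μ K n k = fieldStrength L M β (klEffectiveAction L M β U μ K klE0 n - counterQuadratic L M β K) k := by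
  rw [klFieldStrength, fieldStrength_sub_counterQuadratic hβ]

/-! ## §2 (E3e)-side: momentum sup-jets of the `K`-separated reading from grid sums, every scale -/

/-- **SINGLE-ORDER BRIDGE** (any representation): if `𝒱^{(n)}[K] − 𝒩_K = map S W` for a grid element `W` (`S = gridSubMatrix β x τ`) and, for ONE
`k ≥ 1`, the pinned OFF-DIAGONAL `(1+|Δx̃₀|+|Δx̃₁|)ᵏ`-weighted sums of `kernel₂ W` are `≤ B` (both spins, every pin), then
`‖Dᵏ evalM (symInterp L (klLocSelfEnergyRe … K n − K∘p))‖ ≤ (2|P|/(|β|L²))·B` at every `q` (the `k`-branch of p1b's `twoLeg_sep_momentumSizes_of_grid_all`,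
which asks all orders at once). -/
theorem twoLeg_sep_iteratedFDeriv_of_grid_offDiag {P : Type*} [Fintype P] [DecidableEq P] {β : ℝ} (hβ : β ≠ 0) (U μ : ℝ) (K : TrigPolyC4v)
    (n : ℕ) (x : P → TorusSite 2 L) (τ : P → ℝ) (W : GrassmannAlgebra ℂ (GridLeg P))
    (hW : klEffectiveAction L M β U μ K klE0 n - counterQuadratic L M β K =
      ExteriorAlgebra.map (Matrix.toLin' (gridSubMatrix L M β x τ)) W)
    {k : ℕ} (hk : 1 ≤ k) {B : ℝ}
    (hBk : ∀ (σ : Fin 2) (p₀ : P), ∑ p₁ : P,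
      (if x p₁ - x p₀ = 0 then (0 : ℝ) else
        (1 + (((x p₁ - x p₀) 0).valMinAbs.natAbs : ℝ) + (((x p₁ - x p₀) 1).valMinAbs.natAbs : ℝ)) ^ k) *
        ‖kernel ℂ W 2 (fun i => ((![p₀, p₁] i, σ), i))‖ ≤ B) :
    ∀ q : Momentum, ‖iteratedFDeriv ℝ k
      (evalM (symInterp L (fun p => klLocSelfEnergyRe L M β U μ K n p - K.eval (latticeMomentum L p)))) q‖ ≤
        2 * (Fintype.card P : ℝ) / (|β| * (L : ℝ) ^ 2) * B := by
  intro q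
  have hfun : (fun p => klLocSelfEnergyRe L M β U μ K n p - K.eval (latticeMomentum L p)) =
      fun p => (∑ σ : Fin 2, ((selfEnergy L M β (ExteriorAlgebra.map (Matrix.toLin' (gridSubMatrix L M β x τ)) W) (omega0 M, p) σ).re +
        (selfEnergy L M β (ExteriorAlgebra.map (Matrix.toLin' (gridSubMatrix L M β x τ)) W) ((omega0 M).rev, p) σ).re)) / 4 := by
    funext p
    rw [klLocSelfEnergyRe_sub_frame_eq_locRe hβ U μ K n p, hW]
  rw [hfun]
  refine (norm_iteratedFDeriv_evalM_symInterp_le_offZero_moments L _ hk q).trans ?_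
  set w : TorusSite 2 L → ℝ := fun z =>
    if z = 0 then (0 : ℝ) else (1 + ((z 0).valMinAbs.natAbs : ℝ) + ((z 1).valMinAbs.natAbs : ℝ)) ^ k with hw
  have hw0 : ∀ z, 0 ≤ w z := fun z => by rw [hw]; dsimp only; split_ifs <;> positivity
  have hweven : ∀ z, w (-z) = w z := fun z => by simp only [hw]; exact offDiagWeight_neg k z
  have h := sum_evenWeight_abs_torusCosCoeff_locRe_map_gridSub_le (L := L) (M := M) hβ x τ W hw0 hweven (B := B)
    (fun σ p₀ => hBk σ p₀)
  refine le_trans (le_of_eq ?_) h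
  rw [sum_filter]
  refine sum_congr rfl fun y _ => ?_
  simp only [hw]
  by_cases hy : y = 0
  · rw [if_neg (not_not.2 hy), if_pos hy, zero_mul]
  · rw [if_pos hy, if_neg hy]

/-- **THE SCALE-`n`, FRAME-`K` MOMENTUM SIZES FROM THE GRID, EVERY ORDER, representation discharged.**  With
`W' := W_n[K] − 𝒩_{K,4M}`, `W_n[K] = effAction (S_{4M}ᵀ C^K_{>Λ_n} S_{4M}) (V_{4M} + 𝒩_{K,4M})`: if for both spins and every grid point `p₀`
`Σ_{p₁} ‖kernel W' 2 ((p₀,σ,+),(p₁,σ,−))‖ ≤ B 0` and the OFF-DIAGONAL weighted sums `Σ_{p₁} [x⃗₁ ≠ x⃗₀](1+|Δx̃₀|+|Δx̃₁|)ᵏ‖kernel W' 2 (…)‖ ≤ B k` (every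
`k ≥ 1`), then for every `k` and `q`: `‖Dᵏ evalM (symInterp L (klLocSelfEnergyRe … K n − K∘p)) q‖ ≤ (2·|GridPoint L 4M|/(|β|L²))·B k`. -/
theorem twoLeg_sep_momentumSizes_of_grid_scale {β : ℝ} (hβ : β ≠ 0) (U μ : ℝ) (K : TrigPolyC4v) (n : ℕ) {B : ℕ → ℝ}
    (hB0 : ∀ (σ : Fin 2) (p₀ : GridPoint L (2 * (2 * M))), ∑ p₁ : GridPoint L (2 * (2 * M)),
      ‖kernel ℂ
        (effAction ℂ ((hubbardGridSub L M β (2 * (2 * M))).transpose * hubbardCovAboveCT L M β μ 0 K (klScale klE0 n) *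
            hubbardGridSub L M β (2 * (2 * M)))
          (hubbardGridInteraction L (2 * (2 * M)) β U + hubbardGridCounterQuadratic L (2 * (2 * M)) β K) -
          hubbardGridCounterQuadratic L (2 * (2 * M)) β K) 2 (fun i => ((![p₀, p₁] i, σ), i))‖ ≤ B 0)
    (hBk : ∀ k, 1 ≤ k → ∀ (σ : Fin 2) (p₀ : GridPoint L (2 * (2 * M))), ∑ p₁ : GridPoint L (2 * (2 * M)),
      (if p₁.2 - p₀.2 = 0 then (0 : ℝ) else
        (1 + (((p₁.2 - p₀.2) 0).valMinAbs.natAbs : ℝ) + (((p₁.2 - p₀.2) 1).valMinAbs.natAbs : ℝ)) ^ k) *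
        ‖kernel ℂ
          (effAction ℂ ((hubbardGridSub L M β (2 * (2 * M))).transpose * hubbardCovAboveCT L M β μ 0 K (klScale klE0 n) *
              hubbardGridSub L M β (2 * (2 * M)))
            (hubbardGridInteraction L (2 * (2 * M)) β U + hubbardGridCounterQuadratic L (2 * (2 * M)) β K) -
            hubbardGridCounterQuadratic L (2 * (2 * M)) β K) 2 (fun i => ((![p₀, p₁] i, σ), i))‖ ≤ B k) :
    ∀ (k : ℕ) (q : Momentum), ‖iteratedFDeriv ℝ k
      (evalM (symInterp L (fun p => klLocSelfEnergyRe L M β U μ K n p - K.eval (latticeMomentum L p)))) q‖ ≤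
        2 * (Fintype.card (GridPoint L (2 * (2 * M))) : ℝ) / (|β| * (L : ℝ) ^ 2) * B k :=
  twoLeg_sep_momentumSizes_of_grid_all hβ U μ K n (fun p : GridPoint L (2 * (2 * M)) => p.2) (fun p => gridTime β (2 * (2 * M)) p.1) _
    (klEffectiveAction_sub_counterQuadratic_eq_map_gridSub_scale hβ U μ K n) hB0 hBk

/-- **ROW B2′'s LEFT SIDE FROM ONE GRID SUM, every scale** (`k = 1`, `‖fderiv‖`-form, representation discharged): if for both spins and every grid point
`p₀` the off-diagonal `(1+|Δx̃₀|+|Δx̃₁|)`-weighted pinned sum of `kernel₂ (W_n[K] − 𝒩_{K,4M})` is `≤ B₁`, then at EVERY `q : Momentum` (in particular on the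
shell tube `{|frameLevel μ K q| ≤ Λ_n}`)
`‖fderiv ℝ (evalM (symInterp L (klLocSelfEnergyRe … K n − K∘p))) q‖ ≤ (2·|GridPoint L 4M|/(|β|L²))·B₁`. -/
theorem twoLeg_sep_fderiv_of_grid_scale {β : ℝ} (hβ : β ≠ 0) (U μ : ℝ) (K : TrigPolyC4v) (n : ℕ) {B₁ : ℝ}
    (hB1 : ∀ (σ : Fin 2) (p₀ : GridPoint L (2 * (2 * M))), ∑ p₁ : GridPoint L (2 * (2 * M)),
      (if p₁.2 - p₀.2 = 0 then (0 : ℝ) else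
        (1 + (((p₁.2 - p₀.2) 0).valMinAbs.natAbs : ℝ) + (((p₁.2 - p₀.2) 1).valMinAbs.natAbs : ℝ)) ^ 1) *
        ‖kernel ℂ
          (effAction ℂ ((hubbardGridSub L M β (2 * (2 * M))).transpose * hubbardCovAboveCT L M β μ 0 K (klScale klE0 n) *
              hubbardGridSub L M β (2 * (2 * M)))
            (hubbardGridInteraction L (2 * (2 * M)) β U + hubbardGridCounterQuadratic L (2 * (2 * M)) β K) -
            hubbardGridCounterQuadratic L (2 * (2 * M)) β K) 2 (fun i => ((![p₀, p₁] i, σ), i))‖ ≤ B₁) :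
    ∀ q : Momentum, ‖fderiv ℝ
      (evalM (symInterp L (fun p => klLocSelfEnergyRe L M β U μ K n p - K.eval (latticeMomentum L p)))) q‖ ≤
        2 * (Fintype.card (GridPoint L (2 * (2 * M))) : ℝ) / (|β| * (L : ℝ) ^ 2) * B₁ := by
  intro q
  have h := twoLeg_sep_iteratedFDeriv_of_grid_offDiag hβ U μ K n (fun p : GridPoint L (2 * (2 * M)) => p.2)
    (fun p => gridTime β (2 * (2 * M)) p.1) _ (klEffectiveAction_sub_counterQuadratic_eq_map_gridSub_scale hβ U μ K n) le_rfl hB1 q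
  rwa [norm_iteratedFDeriv_one] at h

/-! ## §3 (E3d)-side: the field strength from the circular grid time moment, every scale -/

/-- **ROW B1′'s LEFT SIDE FROM ONE GRID SUM, every scale, keyed on `W_n[K]`**: if the circular temporal first moment of the two-leg kernel of
`W_n[K] = effAction (S_{4M}ᵀ C^K_{>Λ_n} S_{4M}) (V_{4M} + 𝒩_{K,4M})` satisfies `Σ_{p₁} (β/4M)·circDist_{4M}(j₀,j₁)·‖kernel W_n[K] 2 ((p₀,σ,+),(p₁,σ,−))‖ ≤ Bᵗ` for
both spins and every grid point, then `|klFieldStrength … K n k⃗ − 1| ≤ (2·4M/β)·Bᵗ` at every torus momentum (hence on the shell). -/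
theorem abs_klFieldStrength_sub_one_le_of_grid_time_moment_scale {β : ℝ} (hβ : 0 < β) (U μ : ℝ) (K : TrigPolyC4v) (n : ℕ)
    (k : TorusSite 2 L) {B : ℝ}
    (hB : ∀ (σ : Fin 2) (p₀ : GridPoint L (2 * (2 * M))), ∑ p₁ : GridPoint L (2 * (2 * M)),
      β / ((2 * (2 * M) : ℕ) : ℝ) * (circDist (2 * (2 * M)) p₀.1.val p₁.1.val : ℝ) *
        ‖kernel ℂ
          (effAction ℂ ((hubbardGridSub L M β (2 * (2 * M))).transpose * hubbardCovAboveCT L M β μ 0 K (klScale klE0 n) *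
              hubbardGridSub L M β (2 * (2 * M)))
            (hubbardGridInteraction L (2 * (2 * M)) β U + hubbardGridCounterQuadratic L (2 * (2 * M)) β K)) 2
          (fun i => ((![p₀, p₁] i, σ), i))‖ ≤ B) :
    |klFieldStrength L M β U μ K n k - 1| ≤ 2 * ((2 * (2 * M) : ℕ) : ℝ) / β * B := by
  haveI : NeZero (2 * (2 * M) : ℕ) := ⟨by have := NeZero.ne M; omega⟩
  rw [klFieldStrength, klEffectiveAction_eq_map_gridSub_scale hβ.ne' U μ K n]
  exact abs_fieldStrength_sub_one_map_gridSub_le_of_time_moment hβ _ _ k hB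

/-- **ROW B1′'s LEFT SIDE FROM ONE GRID SUM, every scale, keyed on `W_n[K] − 𝒩_{K,4M}`** (the SAME grid element as §2; the counterterm is invisible
to the field strength): `|klFieldStrength … K n k⃗ − 1| ≤ (2·4M/β)·Bᵗ` from the circular temporal first moment of `kernel₂ (W_n[K] − 𝒩_{K,4M})`. -/
theorem abs_klFieldStrength_sub_one_le_of_grid_time_moment_sub_counter_scale {β : ℝ} (hβ : 0 < β) (U μ : ℝ) (K : TrigPolyC4v) (n : ℕ)
    (k : TorusSite 2 L) {B : ℝ}
    (hB : ∀ (σ : Fin 2) (p₀ : GridPoint L (2 * (2 * M))), ∑ p₁ : GridPoint L (2 * (2 * M)),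
      β / ((2 * (2 * M) : ℕ) : ℝ) * (circDist (2 * (2 * M)) p₀.1.val p₁.1.val : ℝ) *
        ‖kernel ℂ
          (effAction ℂ ((hubbardGridSub L M β (2 * (2 * M))).transpose * hubbardCovAboveCT L M β μ 0 K (klScale klE0 n) *
              hubbardGridSub L M β (2 * (2 * M)))
            (hubbardGridInteraction L (2 * (2 * M)) β U + hubbardGridCounterQuadratic L (2 * (2 * M)) β K) -
            hubbardGridCounterQuadratic L (2 * (2 * M)) β K) 2
          (fun i => ((![p₀, p₁] i, σ), i))‖ ≤ B) :
    |klFieldStrength L M β U μ K n k - 1| ≤ 2 * ((2 * (2 * M) : ℕ) : ℝ) / β * B := by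
  haveI : NeZero (2 * (2 * M) : ℕ) := ⟨by have := NeZero.ne M; omega⟩
  rw [klFieldStrength_eq_fieldStrength_sub_counter hβ.ne' U μ K n, klEffectiveAction_sub_counterQuadratic_eq_map_gridSub_scale hβ.ne' U μ K n]
  exact abs_fieldStrength_sub_one_map_gridSub_le_of_time_moment hβ _ _ k hB

end Summit.HubbardSuperconductivity.HubbardSuperconductivity.Theorems.TwoLegFourier

end
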